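import Summits.RiemannHypothesis.RiemannHypothesis.Theorems.PfPersistenceJointReaders

/-!
# F6 — SCALE-FREE LADDER READERS: a `k`-window look-ahead conjunction of a scale-free foot-ladder reader cannot see a
per-window rescaling of the ladders (pub-rhpf FAKE SEAT 6, gen 2; GAP rows C8-N3 / C8-CLOSE-4, cand8-003 LADDER, cand8-006 `K2`).
mechanism/rigidity campaign; no RH claims.

KERNEL content (all PROVED, no sorry; bookkeeping):
* `signedLadder c e o`      — cand-8's SIGNED foot ladder of record on the two bottom pairs (ladders indexed from `0`):
                              `e₀ < o₀ < e₁ < o₁`, `0 < o₀`, `|e₀|·e₁ ≤ c·o₀²`, `o₀·o₁ ≤ c·e₁²` (row constant `c = 10^{1/4}`, kept a parameter).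
* `ScaleFree P`             — a two-ladder predicate invariant under a common positive rescaling of both ladders.
* `signedLadder_scaleFree`, `sbOrdered_scaleFree` — the signed ladder and the typer's sign-blind ordering `sbOrdered` are scale-free.
* `lookAheadConj P k E O`   — the `k`-window look-ahead conjunction `∀ j < k, P (E j) (O j)` of a two-ladder reader (`K2` = `k = 2`).
* `lookAheadConj_rescale`   — if `P` is scale-free, the conjunction takes the same value on any family of ladders obtained by rescaling
                              each window's pair by its own positive factor `t j`.

CONSEQUENCE recorded in HOME/GAP-CLASSES.md (C8-N3-INHABITED) and FAKES §6.6: no conjunct of `K2 = LADDER(w) ∧ LADDER(w⁺)` constrains the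
absolute scale of the `w⁺` ladder, so a fake whose `w⁺` feet COLLAPSE by several decades but keep an ordered, `o₀`-positive, log-concave
shape is read exactly like ζ there; the transport twins F6-TT2-* use this freedom (DATA: design + two-engine certificates in HOME/certs/fake6/TT2/).
The theorem is the typed reason, not the instances: it says which extra conjunct a sound `k = 2` reader needs (one that is NOT scale-free
across windows, e.g. a bound on `lg(e₁(w)/e₁(w⁺))`).
-/

set_option linter.dupNamespace false  -- the mandated namespace repeats `RiemannHypothesis`

noncomputable section

namespace Summit.RiemannHypothesis.RiemannHypothesis.Theorems.PfPersistence.F6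

open Summit.RiemannHypothesis.RiemannHypothesis.Theorems.PfPersistence

/-- cand-8's SIGNED FOOT LADDER of record (cand8-003 `LADDER`) on the two bottom even/odd pairs, with log-concavity constant `c`
(the row's value is `10^{1/4}`): alternation `e₀ < o₀ < e₁ < o₁`, `o₀ > 0`, and the two cross-parity log-concavity inequalities. [folklore] -/
def signedLadder (c : ℝ) (e o : ℕ → ℝ) : Prop :=
  e 0 < o 0 ∧ o 0 < e 1 ∧ e 1 < o 1 ∧ 0 < o 0 ∧ |e 0| * e 1 ≤ c * (o 0) ^ 2 ∧ o 0 * o 1 ≤ c * (e 1) ^ 2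

/-- a two-ladder predicate is SCALE-FREE when a common positive rescaling of both ladders does not change it. [folklore] -/
def ScaleFree (P : (ℕ → ℝ) → (ℕ → ℝ) → Prop) : Prop :=
  ∀ (e o : ℕ → ℝ) (t : ℝ), 0 < t → (P (fun k => t * e k) (fun k => t * o k) ↔ P e o)

/-- PROVED: the signed ladder is scale-free (every conjunct is homogeneous). [folklore] -/
theorem signedLadder_scaleFree (c : ℝ) : ScaleFree (signedLadder c) := by
  intro e o t ht
  have h2 : (0 : ℝ) < t ^ 2 := by positivity
  simp only [signedLadder, abs_mul, abs_of_pos ht]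
  have A : ∀ x y : ℝ, t * x < t * y ↔ x < y := fun x y =>
    ⟨fun h => lt_of_mul_lt_mul_left h ht.le, fun h => mul_lt_mul_of_pos_left h ht⟩
  have L : ∀ x y : ℝ, t ^ 2 * x ≤ t ^ 2 * y ↔ x ≤ y := fun x y =>
    ⟨fun h => le_of_mul_le_mul_left h h2, fun h => mul_le_mul_of_nonneg_left h h2.le⟩
  have B : (0 : ℝ) < t * o 0 ↔ 0 < o 0 := by
    simpa using A 0 (o 0)
  have C : t * |e 0| * (t * e 1) ≤ c * (t * o 0) ^ 2 ↔ |e 0| * e 1 ≤ c * (o 0) ^ 2 := by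
    rw [show t * |e 0| * (t * e 1) = t ^ 2 * (|e 0| * e 1) by ring, show c * (t * o 0) ^ 2 = t ^ 2 * (c * (o 0) ^ 2) by ring]
    exact L _ _
  have D : t * o 0 * (t * o 1) ≤ c * (t * e 1) ^ 2 ↔ o 0 * o 1 ≤ c * (e 1) ^ 2 := by
    rw [show t * o 0 * (t * o 1) = t ^ 2 * (o 0 * o 1) by ring, show c * (t * e 1) ^ 2 = t ^ 2 * (c * (e 1) ^ 2) by ring]
    exact L _ _
  rw [A, A, A, B, C, D]

/-- PROVED: the typer's sign-blind moduli ordering `sbOrdered` is scale-free too. [folklore] -/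
theorem sbOrdered_scaleFree : ScaleFree sbOrdered := by
  intro e o t ht
  simp only [sbOrdered, abs_mul, abs_of_pos ht]
  have A : ∀ x y : ℝ, t * x < t * y ↔ x < y := fun x y =>
    ⟨fun h => lt_of_mul_lt_mul_left h ht.le, fun h => mul_lt_mul_of_pos_left h ht⟩
  rw [A, A, A]

/-- PROVED: a conjunction of scale-free predicates is scale-free. [folklore] -/
theorem ScaleFree.and {P Q : (ℕ → ℝ) → (ℕ → ℝ) → Prop} (hP : ScaleFree P) (hQ : ScaleFree Q) :
    ScaleFree fun e o => P e o ∧ Q e o := fun e o t ht => by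
  simp only [hP e o t ht, hQ e o t ht]

/-- the `k`-WINDOW LOOK-AHEAD CONJUNCTION of a two-ladder reader `P` along a served series of windows `j = 0, 1, …`
(`E j`, `O j` = the even / odd ladders the SAME object shows at the `j`-th window): cand8-006 `K2` is `k = 2` with
`P = signedLadder 10^{1/4}`, cand8-007 `K3` is `k = 3`. [folklore] -/
def lookAheadConj (P : (ℕ → ℝ) → (ℕ → ℝ) → Prop) (k : ℕ) (E O : ℕ → ℕ → ℝ) : Prop :=
  ∀ j < k, P (E j) (O j)

/-- PROVED (the typed reason the transport twins exist): if the one-window reader `P` is scale-free, its `k`-window look-ahead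
conjunction cannot distinguish a family of ladders from the family obtained by rescaling EACH window's pair by its own positive
factor `t j` — in particular it puts no constraint on how fast the ladder's absolute scale falls from one served window to the next. [folklore] -/
theorem lookAheadConj_rescale {P : (ℕ → ℝ) → (ℕ → ℝ) → Prop} (hP : ScaleFree P) (k : ℕ) (E O : ℕ → ℕ → ℝ)
    (t : ℕ → ℝ) (ht : ∀ j < k, 0 < t j) :
    lookAheadConj P k (fun j n => t j * E j n) (fun j n => t j * O j n) ↔ lookAheadConj P k E O := by
  unfold lookAheadConj
  exact forall₂_congr fun j hj => hP (E j) (O j) (t j) (ht j hj)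

/-- PROVED (monotonicity in the slack): a larger log-concavity constant only weakens the signed ladder. [folklore] -/
theorem signedLadder.mono {c c' : ℝ} (h : c ≤ c') {e o : ℕ → ℝ} (hL : signedLadder c e o) : signedLadder c' e o := by
  obtain ⟨h1, h2, h3, h4, h5, h6⟩ := hL
  have ho : 0 ≤ (o 0) ^ 2 := sq_nonneg _
  have he : 0 ≤ (e 1) ^ 2 := sq_nonneg _
  exact ⟨h1, h2, h3, h4, h5.trans (mul_le_mul_of_nonneg_right h ho), h6.trans (mul_le_mul_of_nonneg_right h he)⟩

end Summit.RiemannHypothesis.RiemannHypothesis.Theorems.PfPersistence.F6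

end
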